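import Mathlib
import Summits.Ventures.PercRepro2.LocRows
import Summits.Ventures.PercRepro2.SwRow

/-!
# Row (SW) with an `h`-hull-local injection — the statement (HL) (blind cell PercRepro2, night-4 g9,
2026-08-25; proofs/NIGHT4-G9.md §4)

Free fibre (uniform 2-colouring, `ζ e = true` red), marks `l, h, o`, `Q = tgtU ends l h {S ∣ o ∈ S}`
= `{h ∉ H_l, o ∈ R_side(l)}`.  Statement (HL): row (SW) holds with an injection `f` that recolours
ONLY edges touching the hull of `h` (`C_R(h) ∪ C_B(h)`) of the source configuration — the transport
is local to `h`'s hull.  It is the refinement of (SW) suggested by the conditioning principle (HLC,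
`SwOut`): an injection of a class of (HLC) fixes the edges off the region, hence off the hull of `h`.
Neither statement is known to imply the other formally: an (HL)-injection may carry a configuration
out of its (HLC) class (the hull of `h` may grow), and the class injections of (HLC) need not glue.

* **`SwHullLocal`** (the statement), `sw_of_swHullLocal : SwHullLocal → Sw`;
* `SwHullLocal_all`, `sw_all_of_swHullLocal_all : SwHullLocal_all → Sw_all`.

Census (own code, exact Hopcroft–Karp on the locality relation): 0 failures on all 709 connected
graphs with n = 7 and m ≤ 13 (73,151 cases), on all connected graphs with n ≤ 6, and on random
connected multigraphs with parallel edges (n ≤ 5).  The `h`-hull-SHRINKING form (hull of the image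
inside the hull of the source) FAILS at n = 7 (14 / 40,581 cases, NEG-93's graphs): the image's hull
may have to grow.  A CONJECTURE of record for the planners, not a theorem.
-/

namespace Summit.Ventures.PercRepro2

namespace LocRows

open Hull

variable {V : Type*} {E : Type*} [Fintype E] [DecidableEq E]

open scoped Classical

variable (ends : E → Sym2 V)

/-- **Statement (HL)**: an injection of `Q` into itself carrying the red cluster of `h` into the blue
cluster of `h` of the image and recolouring only edges touching the hull of `h` of the source. -/
def SwHullLocal (l h o : V) : Prop :=
  ∃ f : {ζ // ζ ∈ tgtU ends l h {S : Set V | o ∈ S}} → Config E, Function.Injective f ∧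
    ∀ x, f x ∈ tgtU ends l h {S : Set V | o ∈ S} ∧
      cluster ends x.1 h ⊆ cluster ends (blue (f x)) h ∧
      ∀ e, f x e ≠ x.1 e → e ∈ touches ends (hull ends x.1 h)

/-- (HL) gives row (SW): forget the locality clause. -/
theorem sw_of_swHullLocal (l h o : V) (hs : SwHullLocal ends l h o) : Sw ends l h o := by
  obtain ⟨f, hf, hx⟩ := hs
  exact ⟨f, hf, fun x => ⟨(hx x).1, (hx x).2.1⟩⟩

/-- (HL) over all finite graphs and markings. -/
def SwHullLocal_all : Prop :=
  ∀ (V E : Type) [Fintype V] [DecidableEq V] [Fintype E] [DecidableEq E] (ends : E → Sym2 V)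
    (l h o : V), l ≠ h → o ≠ l → o ≠ h → SwHullLocal ends l h o

/-- `SwHullLocal_all` gives `Sw_all`. -/
theorem sw_all_of_swHullLocal_all (hs : SwHullLocal_all) : Sw_all := by
  intro V E _ _ _ _ ends l h o hlh hol hoh
  exact sw_of_swHullLocal ends l h o (hs V E ends l h o hlh hol hoh)

end LocRows

end Summit.Ventures.PercRepro2
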